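import Mathlib
import HarnessLib

/-!
# Counting formulas for CM types (Kida 2019): the numbers of CM types of a triple `(G, H, ρ)` with
# prescribed field and reflex subgroups, of simple (= primitive) CM types, and of conjugacy classes

Layer `Literature/NumberTheory/ComplexMultiplication`.  Source of record: M. Kida, *Counting formulas for
CM-types*, Moscow J. Combin. Number Theory **8** (2019) 343–355 [Kida2019CountingCMTypes] (held
`paper:doi-10-2140-moscow-2019-8-343`, read in full).  Everything below is PROVED; the definitions are honest
(finite sets of half-systems, two stabiliser subgroups, Kida's function `ε`); no named fact (D-0014/D-0026).

## The setting [Kida2019CountingCMTypes, §1]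

«Throughout this paper, we will use the following purely group-theoretic setting.  Let `G` be a finite group, and
`ρ` a central involution of `G` fixed once for all.»  For a CM field `M` with Galois closure `L`, `G = Gal(L/ℚ)`,
`H = Gal(L/M)`, `ρ` = complex conjugation; «we define a family `𝓗` of subgroups of `G` by `𝓗 = {H ≤ G | ρ ∉ H}` …
we call such an `H` a CM subgroup of `G`».  A CM type of `(G, H, ρ)` is a half set of the coset space of `H`, and
Kida works with its pull-back `S̃ ⊆ G`, with `s(S) = {g ∈ G | g S̃ = S̃}` (1-2) and `r(S) = {g ∈ G | S̃ g = S̃}` (1-3);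
«a CM-type `S ∈ CM(G, H, ρ)` is called simple if `s(S) = H`», and `r(S)` is «the reflex subgroup of `S`».

CONVENTION (the tree's, = Schmidt LNM 1082 Kap. II Bem. 1.4 and Shimura §8.2, as in the sibling files
`PrimitiveCMTypeExistenceGalois`, `PrimitiveHalfSystemNonNormalSubgroup`): a CM type of the field `L^H` is a
HALF-SYSTEM `S ⊆ G` (`x ∈ S ↔ ρx ∉ S`) with `S·H = S`, i.e. a union of LEFT cosets `gH`; it is PRIMITIVE (= Kida's
«simple») iff its RIGHT stabiliser `{γ | Sγ = S}` is exactly `H`, and its LEFT stabiliser `{γ | γS = S}` is the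
reflex subgroup `Gal(L/K')`.  Kida writes right cosets `Hg`; the two conventions correspond under `S ↦ S⁻¹`, which
exchanges left and right stabilisers (`rightStab_inv`, `leftStab_inv` below), so every statement of the paper is
typed here with (Kida's `s`) = `rightStab`, (Kida's `r`) = `leftStab`, and Kida's conjugation `S ↦ Sg` = left
translation `S ↦ gS`.

## Contents

* §1 half-systems, the two stabilisers (both avoid `ρ`: «it is easy to see that `s(S)` and `r(S)` are members of
  `𝓗`»), inversion and translation; Kida's sets `X(H,K)`, `X̄(H,K)` (2-1)/(2-2), `𝒮(H)`, `𝒮̄(H) = CM(G,H,ρ)`,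
  `ℛ(K)`, `ℛ̄(K)` (3-1)–(3-4).
* §2 the function `ε` (Def. 2.1) and LEMMA 2.2 (i)–(iv); `ε(H,K) = 1` iff no double coset `KxH` equals `KρxH`.
* §3 LEMMA 2.3: `|X̄(H,K)| = ε(H,K)·2^{½|K\G/H|}` (a member of `X̄(H,K)` is a union of double cosets `KxH`, one out
  of each pair `{KxH, KρxH}`); in particular `|CM(G,H,ρ)| = 2^{½(G:H)}` and there are `2^{|G|/2}` half-systems.
* §4 THEOREM 2.4 (the fundamental formula, Möbius inversion on `𝓗 × 𝓗` — Mathlib's `IncidenceAlgebra.mu` on the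
  lattice `Subgroup G`, whose intervals inside `𝓗` are those of `𝓗`), COROLLARY 2.5 (`|X(H,K)| = |X(K,H)|`, here by
  the bijection `S ↦ S⁻¹`), COROLLARIES 2.6–2.7 (normal subgroups), COROLLARY 2.8 (conjugation invariance, here by
  `S ↦ ySx⁻¹`), PROPOSITION 3.1 (the number of simple CM types `|𝒮(H)| = Σ_{N ⊇ H} μ(H,N)·2^{½(G:N)}`),
  COROLLARY 3.2, PROPOSITION 3.3, COROLLARY 3.4 (corrected form, see below).
* §5 THEOREM 4.1: the number `c(G,H,ρ)` of conjugacy classes of CM types satisfies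
  `|G|·c(G,H,ρ) = Σ_{S ∈ CM(G,H,ρ)} |r(S)| = Σ_K |K|·|𝒮̄(H) ∩ ℛ(K)|` (Burnside), and REMARK 4.3
  (`Σ_{classes} [L_K : ℚ] = Σ_{classes} (G : r(S)) = 2^{½(G:H)}`, «previously noticed by Dodson [1984, p. 5]»).

HONEST COLUMN.  (1) Corollary 3.4 is printed as «`|𝒮̄(H) ∩ ℛ(K)| = |𝒮̄(K) ∩ ℛ(H)|`»; its proof computes
`Σ_{K₁ ⊇ K} |X(H, K₁)| = Σ_{K₁ ⊇ K} |X(K₁, H)|`, i.e. `|𝒮(H) ∩ ℛ̄(K)| = |𝒮̄(K) ∩ ℛ(H)|`, which is what is proved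
here (`card_simpleTypes_filter_le_leftStab_eq`); the printed form fails already for `G = V₄`, `H = 1`, `K = {1, a}`
(left side `≥ 1`, right side `0`: `card_cmTypes_filter_ne_of_isCompl`).  Example 6.3 of the paper invokes Cor. 3.4 only through the correct
quantity `|𝒮̄(H₁) ∩ ℛ(1)| = |𝒮(1) ∩ ℛ̄(H₁)|`.  (2) Corollary 2.6 (i) is an «iff» in print; the direction
`H = K ⟹ X(H, K) ≠ ∅` needs a simple CM type to exist (false for `V₄`, `D₄`, Lemma 6.1) and is not asserted here.
(3) Proposition 4.2 («the number of conjugacy classes in `𝒮̄(H) ∩ ℛ(K)` is `|K|/|G|·|𝒮̄(H) ∩ ℛ(K)|`») is typed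
in its exact content, orbit–stabiliser `|G·S| = (G : r(S))`; the set `𝒮̄(H) ∩ ℛ(K)` is `G`-stable only for normal
`K`, and only the sum over `K` (Theorem 4.1) is asserted.  (4) Corollaries 2.5, 2.8, 3.2 are proved by explicit
bijections (`S ↦ S⁻¹`, `S ↦ ySx⁻¹`) rather than from the formula; Mathlib's Möbius function on the lattice
`Subgroup G` replaces Kida's `μ` on `𝓗` (same values on `𝓗`, which is a lower set).

NOT here (sequel `CMTypeCountingFormulasExamples`): §5 (degenerate CM types from `|r(S)| ≠ |s(S)|`) and the
examples of §6.

## References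

* [Kida2019CountingCMTypes] M. Kida, *Counting formulas for CM-types*, Moscow J. Combin. Number Theory 8 (2019),
  no. 4, 343–355, doi:10.2140/moscow.2019.8.343 — §1 (1-1)–(1-5); §2 Def. 2.1, Lemma 2.2, Lemma 2.3, Thm. 2.4,
  Cor. 2.5–2.8; §3 (3-1)–(3-4), Prop. 3.1, Cor. 3.2, Prop. 3.3, Cor. 3.4; §4 Thm. 4.1, Prop. 4.2, Rem. 4.3.
* [Dodson1984] B. Dodson, *The structure of Galois groups of CM-fields*, Trans. AMS 283 (1984), p. 5 (the sum of the
  reflex degrees over the classes of types).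
* [Schmidt1984CMArithmetik] C.-G. Schmidt, *Arithmetik abelscher Varietäten mit komplexer Multiplikation*, LNM 1082,
  Kap. II Def. 1.3, Bem. 1.4 (half-systems `S·H = S` of `(G, H, ρ)`).
* [Rota1964] G.-C. Rota, *On the foundations of combinatorial theory I*, Z. Wahrsch. 2 (1964), Prop. 3 and 5
  (Möbius inversion; product posets) — Mathlib `IncidenceAlgebra.moebius_inversion_top`, `mu_prod_mu`.

## Provenance

Cell `pub-hodgecm2` (COR-CM), literature seat `lit-deligne-3` gen 26 (PORTFOLIO-PASS «Deligne 1982 continued: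
CM-type combinatorics»; claim KIDA-COUNT; count-neutral).  `HC_CM` is neither used nor implied.
-/

set_option autoImplicit false

noncomputable section

open scoped Classical Pointwise BigOperators

namespace Literature.NumberTheory.ComplexMultiplication

namespace CMTypeCounting

variable {G : Type*} [Group G]

/-! ## §1 Half-systems of `(G, ρ)`, their two stabilisers, and Kida's sets -/

/-- `S ⊆ G` is a HALF-SYSTEM for the involution `ρ`: it contains exactly one element of each pair `{x, ρx}` — the
pull-back `S̃ ⊆ G` of a CM type («a half set `S` … `M = S ⊔ Sρ`»). [cite: Kida2019CountingCMTypes, §1] -/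
def IsHalfSystem (ρ : G) (S : Finset G) : Prop := ∀ x : G, x ∈ S ↔ ρ * x ∉ S

/-- The RIGHT stabiliser `{γ ∈ G | Sγ = S}` of `S ⊆ G` — Kida's `s(S) = {g | g S̃ = S̃}` (1-2) read through
`S ↦ S⁻¹`; for a CM type of the field `L^H` it contains `H`, with equality iff the type is simple (primitive).
[cite: Kida2019CountingCMTypes, §1 (1-2)] -/
def rightStab (S : Finset G) : Subgroup G where
  carrier := {g | ∀ x : G, x * g ∈ S ↔ x ∈ S}
  one_mem' := fun x => by rw [mul_one]
  mul_mem' := fun {a b} ha hb x => by rw [← mul_assoc, hb, ha]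
  inv_mem' := fun {a} ha x => by
    have h := ha (x * a⁻¹)
    rw [inv_mul_cancel_right] at h
    exact h.symm

/-- The LEFT stabiliser `{γ ∈ G | γS = S}` of `S ⊆ G` — Kida's reflex subgroup `r(S) = {g | S̃ g = S̃}` (1-3) read
through `S ↦ S⁻¹` (for a CM type it is `Gal(L/K')`, `K'` the reflex field). [cite: Kida2019CountingCMTypes, §1 (1-3)] -/
def leftStab (S : Finset G) : Subgroup G where
  carrier := {g | ∀ x : G, g * x ∈ S ↔ x ∈ S}
  one_mem' := fun x => by rw [one_mul]
  mul_mem' := fun {a b} ha hb x => by rw [mul_assoc, ha, hb]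
  inv_mem' := fun {a} ha x => by
    have h := ha (a⁻¹ * x)
    rw [mul_inv_cancel_left] at h
    exact h.symm

/-- Membership in the right stabiliser (unfolding). [cite: Kida2019CountingCMTypes, §1 (1-2)] -/
theorem mem_rightStab_iff {S : Finset G} {g : G} : g ∈ rightStab S ↔ ∀ x : G, x * g ∈ S ↔ x ∈ S := Iff.rfl

/-- Membership in the left stabiliser (unfolding). [cite: Kida2019CountingCMTypes, §1 (1-3)] -/
theorem mem_leftStab_iff {S : Finset G} {g : G} : g ∈ leftStab S ↔ ∀ x : G, g * x ∈ S ↔ x ∈ S := Iff.rfl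

section Finite

variable [Fintype G]

/-- The set of all half-systems of `(G, ρ)` (= `CM(G, 1, ρ)`, the CM types of the Galois CM field `L` itself).
[cite: Kida2019CountingCMTypes, §1] -/
def halfSystems (ρ : G) : Finset (Finset G) := Finset.univ.filter fun S => IsHalfSystem ρ S

/-- `CM(G, H, ρ)` = Kida's `𝒮̄(H)` (3-2): the half-systems right-stable under `H` (`S·H = S`, the CM types of the
field `L^H`; Kida: `s(S) ⊇ H`). [cite: Kida2019CountingCMTypes, §3 (3-2)] -/
def cmTypes (ρ : G) (H : Subgroup G) : Finset (Finset G) := (halfSystems ρ).filter fun S => H ≤ rightStab S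

/-- Kida's `𝒮(H)` (3-1): the half-systems whose right stabiliser is EXACTLY `H` — the SIMPLE (= primitive) CM types of
`(G, H, ρ)`. [cite: Kida2019CountingCMTypes, §3 (3-1)] -/
def simpleTypes (ρ : G) (H : Subgroup G) : Finset (Finset G) := (halfSystems ρ).filter fun S => rightStab S = H

/-- Kida's `ℛ(K)` (3-3): the half-systems whose reflex subgroup (left stabiliser) is exactly `K`.
[cite: Kida2019CountingCMTypes, §3 (3-3)] -/
def reflexTypes (ρ : G) (K : Subgroup G) : Finset (Finset G) := (halfSystems ρ).filter fun S => leftStab S = K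

/-- Kida's `ℛ̄(K)` (3-4): the half-systems whose reflex subgroup contains `K` (`K·S = S`).
[cite: Kida2019CountingCMTypes, §3 (3-4)] -/
def reflexTypesGE (ρ : G) (K : Subgroup G) : Finset (Finset G) := (halfSystems ρ).filter fun S => K ≤ leftStab S

/-- Kida's `X(H, K) = {S ∈ CM(G, 1, ρ) | s(S) = H and r(S) = K}` (2-1): half-systems with right stabiliser exactly `H`
and left stabiliser exactly `K`. [cite: Kida2019CountingCMTypes, §2 (2-1)] -/
def X (ρ : G) (H K : Subgroup G) : Finset (Finset G) :=
  (halfSystems ρ).filter fun S => rightStab S = H ∧ leftStab S = K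

/-- Kida's `X̄(H, K) = {S ∈ CM(G, 1, ρ) | s(S) ⊇ H and r(S) ⊇ K}` (2-2): half-systems with `S·H = S` and `K·S = S`.
[cite: Kida2019CountingCMTypes, §2 (2-2)] -/
def Xbar (ρ : G) (H K : Subgroup G) : Finset (Finset G) :=
  (halfSystems ρ).filter fun S => H ≤ rightStab S ∧ K ≤ leftStab S

variable {ρ : G}

/-- Membership in `halfSystems ρ` (unfolding). [cite: Kida2019CountingCMTypes, §1] -/
@[simp] theorem mem_halfSystems {S : Finset G} : S ∈ halfSystems ρ ↔ IsHalfSystem ρ S := by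
  simp [halfSystems]

/-- Membership in `CM(G,H,ρ)` (unfolding). [cite: Kida2019CountingCMTypes, §3 (3-2)] -/
@[simp] theorem mem_cmTypes {H : Subgroup G} {S : Finset G} :
    S ∈ cmTypes ρ H ↔ IsHalfSystem ρ S ∧ H ≤ rightStab S := by
  simp [cmTypes]

/-- Membership in `𝒮(H)` (unfolding). [cite: Kida2019CountingCMTypes, §3 (3-1)] -/
@[simp] theorem mem_simpleTypes {H : Subgroup G} {S : Finset G} :
    S ∈ simpleTypes ρ H ↔ IsHalfSystem ρ S ∧ rightStab S = H := by
  simp [simpleTypes]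

/-- Membership in `ℛ(K)` (unfolding). [cite: Kida2019CountingCMTypes, §3 (3-3)] -/
@[simp] theorem mem_reflexTypes {K : Subgroup G} {S : Finset G} :
    S ∈ reflexTypes ρ K ↔ IsHalfSystem ρ S ∧ leftStab S = K := by
  simp [reflexTypes]

/-- Membership in `ℛ̄(K)` (unfolding). [cite: Kida2019CountingCMTypes, §3 (3-4)] -/
@[simp] theorem mem_reflexTypesGE {K : Subgroup G} {S : Finset G} :
    S ∈ reflexTypesGE ρ K ↔ IsHalfSystem ρ S ∧ K ≤ leftStab S := by
  simp [reflexTypesGE]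

/-- Membership in `X(H,K)` (unfolding). [cite: Kida2019CountingCMTypes, §2 (2-1)] -/
@[simp] theorem mem_X {H K : Subgroup G} {S : Finset G} :
    S ∈ X ρ H K ↔ IsHalfSystem ρ S ∧ rightStab S = H ∧ leftStab S = K := by
  simp [X]

/-- Membership in `X̄(H,K)` (unfolding). [cite: Kida2019CountingCMTypes, §2 (2-2)] -/
@[simp] theorem mem_Xbar {H K : Subgroup G} {S : Finset G} :
    S ∈ Xbar ρ H K ↔ IsHalfSystem ρ S ∧ H ≤ rightStab S ∧ K ≤ leftStab S := by
  simp [Xbar]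

end Finite

/-! ### Basic properties of half-systems -/

namespace IsHalfSystem

variable {ρ : G} {S : Finset G}

/-- `ρx ∈ S ↔ x ∉ S` for a half-system (`ρ` an involution). [cite: Kida2019CountingCMTypes, §1] -/
theorem rho_mul_mem_iff (hS : IsHalfSystem ρ S) (hρ2 : ρ * ρ = 1) (x : G) : ρ * x ∈ S ↔ x ∉ S := by
  have h := hS (ρ * x)
  rw [← mul_assoc, hρ2, one_mul] at h
  tauto

/-- `xρ ∈ S ↔ x ∉ S` for a half-system (`ρ` central). [cite: Kida2019CountingCMTypes, §1] -/
theorem mul_rho_mem_iff (hS : IsHalfSystem ρ S) (hρc : ∀ g : G, g * ρ = ρ * g) (hρ2 : ρ * ρ = 1) (x : G) :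
    x * ρ ∈ S ↔ x ∉ S := by
  rw [hρc, hS.rho_mul_mem_iff hρ2]

/-- A half-system exists only for `ρ ≠ 1`. [cite: Kida2019CountingCMTypes, §1] -/
theorem rho_ne_one (hS : IsHalfSystem ρ S) : ρ ≠ 1 := by
  rintro rfl
  have h := hS 1
  rw [mul_one] at h
  exact iff_not_self h

/-- `ρ ∉ s(S)`: the right stabiliser of a half-system is a CM subgroup («it is easy to see that `s(S)` and `r(S)` are
members of `𝓗`»). [cite: Kida2019CountingCMTypes, §1] -/
theorem rho_not_mem_rightStab (hS : IsHalfSystem ρ S) (hρc : ∀ g : G, g * ρ = ρ * g) (hρ2 : ρ * ρ = 1) :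
    ρ ∉ rightStab S := by
  intro h
  have h1 := (mem_rightStab_iff.1 h) 1
  rw [hS.mul_rho_mem_iff hρc hρ2] at h1
  exact iff_not_self h1.symm

/-- `ρ ∉ r(S)`: the reflex subgroup (left stabiliser) of a half-system is a CM subgroup.
[cite: Kida2019CountingCMTypes, §1] -/
theorem rho_not_mem_leftStab (hS : IsHalfSystem ρ S) (hρ2 : ρ * ρ = 1) : ρ ∉ leftStab S := by
  intro h
  have h1 := (mem_leftStab_iff.1 h) 1
  rw [hS.rho_mul_mem_iff hρ2] at h1
  exact iff_not_self h1.symm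

/-- A CM subgroup in Kida's sense: every subgroup of the right stabiliser avoids `ρ`.
[cite: Kida2019CountingCMTypes, §1 (1-1)] -/
theorem rho_not_mem_of_le_rightStab (hS : IsHalfSystem ρ S) (hρc : ∀ g : G, g * ρ = ρ * g) (hρ2 : ρ * ρ = 1)
    {H : Subgroup G} (hH : H ≤ rightStab S) : ρ ∉ H :=
  fun h => hS.rho_not_mem_rightStab hρc hρ2 (hH h)

/-- Every subgroup of the reflex subgroup avoids `ρ`. [cite: Kida2019CountingCMTypes, §1 (1-1)] -/
theorem rho_not_mem_of_le_leftStab (hS : IsHalfSystem ρ S) (hρ2 : ρ * ρ = 1) {K : Subgroup G}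
    (hK : K ≤ leftStab S) : ρ ∉ K :=
  fun h => hS.rho_not_mem_leftStab hρ2 (hK h)

/-- Left multiplication by `ρ` maps a half-system onto its complement. [cite: Kida2019CountingCMTypes, §1] -/
theorem image_rho_mul_eq_compl [Fintype G] (hS : IsHalfSystem ρ S) (hρ2 : ρ * ρ = 1) :
    S.image (fun x => ρ * x) = Finset.univ \ S := by
  ext y
  simp only [Finset.mem_image, Finset.mem_sdiff, Finset.mem_univ, true_and]
  constructor
  · rintro ⟨x, hx, rfl⟩
    exact (hS x).1 hx
  · intro hy
    refine ⟨ρ * y, (hS.rho_mul_mem_iff hρ2 y).2 hy, ?_⟩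
    rw [← mul_assoc, hρ2, one_mul]

/-- A half-system has `|G|/2` elements («`|Φ_M| = 2d` … a half set»). [cite: Kida2019CountingCMTypes, §1] -/
theorem two_mul_card [Fintype G] (hS : IsHalfSystem ρ S) (hρ2 : ρ * ρ = 1) :
    2 * S.card = Fintype.card G := by
  have hinj : Set.InjOn (fun x => ρ * x) (S : Set G) := fun x _ y _ hxy => mul_left_cancel hxy
  have h1 : (S.image fun x => ρ * x).card = S.card := Finset.card_image_of_injOn hinj
  have h2 := Finset.card_sdiff_add_card_eq_card (Finset.subset_univ S)
  rw [← hS.image_rho_mul_eq_compl hρ2, h1, Finset.card_univ] at h2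
  omega

/-- The INVERSE `S⁻¹` of a half-system is a half-system (`ρ` central): the dictionary between Kida's right cosets
`Hg` and the tree's left cosets `gH`. [cite: Kida2019CountingCMTypes, §1] -/
theorem inv (hS : IsHalfSystem ρ S) (hρc : ∀ g : G, g * ρ = ρ * g) (hρ2 : ρ * ρ = 1) : IsHalfSystem ρ S⁻¹ := by
  intro x
  have hρinv : ρ⁻¹ = ρ := inv_eq_of_mul_eq_one_right hρ2
  rw [Finset.mem_inv', Finset.mem_inv', mul_inv_rev, hρinv, hρc, hS.rho_mul_mem_iff hρ2, not_not]

/-- Under `S ↦ S⁻¹` the right stabiliser becomes the left stabiliser: Kida's `s(S)` IS the tree's right stabiliser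
of `S̃⁻¹`. [cite: Kida2019CountingCMTypes, §1 (1-2)] -/
theorem _root_.Literature.NumberTheory.ComplexMultiplication.CMTypeCounting.rightStab_inv (S : Finset G) :
    rightStab S⁻¹ = leftStab S := by
  ext g
  simp only [mem_rightStab_iff, mem_leftStab_iff, Finset.mem_inv', mul_inv_rev]
  constructor
  · intro h y
    have h1 := h (y⁻¹ * g⁻¹)
    rw [mul_inv_rev, inv_inv, inv_inv, inv_mul_cancel_left] at h1
    exact h1.symm
  · intro h x
    have h1 := h (g⁻¹ * x⁻¹)
    rw [mul_inv_cancel_left] at h1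
    exact h1.symm

/-- Under `S ↦ S⁻¹` the left stabiliser becomes the right stabiliser: Kida's reflex subgroup `r(S)` IS the tree's
left stabiliser of `S̃⁻¹`. [cite: Kida2019CountingCMTypes, §1 (1-3)] -/
theorem _root_.Literature.NumberTheory.ComplexMultiplication.CMTypeCounting.leftStab_inv (S : Finset G) :
    leftStab S⁻¹ = rightStab S := by
  have h := rightStab_inv S⁻¹
  rw [inv_inv] at h
  exact h.symm

/-- A LEFT translate `gS` of a half-system is a half-system (`ρ` central) — Kida's conjugate `Sg` read through
`S ↦ S⁻¹` («Two CM-types `S₁` and `S₂` … are conjugate if there exists `g ∈ G` such that `S₁ = S₂g`»).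
[cite: Kida2019CountingCMTypes, §1] -/
theorem smul (hS : IsHalfSystem ρ S) (hρc : ∀ g : G, g * ρ = ρ * g) (g : G) : IsHalfSystem ρ (g • S) := by
  intro x
  rw [← Finset.inv_smul_mem_iff, ← Finset.inv_smul_mem_iff, smul_eq_mul, smul_eq_mul, ← mul_assoc, hρc g⁻¹,
    mul_assoc]
  exact hS _

/-- A RIGHT translate `Sg` of a half-system is a half-system. [cite: Kida2019CountingCMTypes, §1] -/
theorem op_smul (hS : IsHalfSystem ρ S) (g : G) : IsHalfSystem ρ (MulOpposite.op g • S) := by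
  intro x
  rw [← Finset.inv_smul_mem_iff, ← Finset.inv_smul_mem_iff, ← MulOpposite.op_inv, op_smul_eq_mul,
    op_smul_eq_mul, mul_assoc]
  exact hS _

end IsHalfSystem

/-- The reflex subgroup of a left translate is the conjugate: `r(gS) = g·r(S)·g⁻¹` (Kida: `r(Sg) = g⁻¹r(S)g`).
[cite: Kida2019CountingCMTypes, §4 (proof of Prop. 4.2)] -/
theorem leftStab_smul (S : Finset G) (g : G) : leftStab (g • S) = MulAut.conj g • leftStab S := by
  ext γ
  rw [Subgroup.mem_pointwise_smul_iff_inv_smul_mem, MulAut.smul_def, MulAut.conj_inv_apply, mem_leftStab_iff,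
    mem_leftStab_iff]
  simp only [← Finset.inv_smul_mem_iff (a := g), smul_eq_mul]
  constructor
  · intro h x
    simpa [mul_assoc] using h (g * x)
  · intro h x
    simpa [mul_assoc] using h (g⁻¹ * x)

/-- Left translation does not change the right stabiliser: `s(gS) = s(S)`. [cite: Kida2019CountingCMTypes, §4] -/
theorem rightStab_smul (S : Finset G) (g : G) : rightStab (g • S) = rightStab S := by
  ext γ
  rw [mem_rightStab_iff, mem_rightStab_iff]
  simp only [← Finset.inv_smul_mem_iff (a := g), smul_eq_mul]
  constructor
  · intro h x
    simpa [mul_assoc] using h (g * x)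
  · intro h x
    simpa [mul_assoc] using h (g⁻¹ * x)

/-- Right translation does not change the left stabiliser. [cite: Kida2019CountingCMTypes, §4] -/
theorem leftStab_op_smul (S : Finset G) (g : G) : leftStab (MulOpposite.op g • S) = leftStab S := by
  ext γ
  rw [mem_leftStab_iff, mem_leftStab_iff]
  simp only [← Finset.inv_smul_mem_iff (a := MulOpposite.op g), ← MulOpposite.op_inv, op_smul_eq_mul]
  constructor
  · intro h x
    simpa [mul_assoc] using h (x * g)
  · intro h x
    simpa [mul_assoc] using h (x * g⁻¹)

/-- The right stabiliser of a right translate is the conjugate `g⁻¹·s(S)·g`. [cite: Kida2019CountingCMTypes, §4] -/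
theorem rightStab_op_smul (S : Finset G) (g : G) :
    rightStab (MulOpposite.op g • S) = MulAut.conj g⁻¹ • rightStab S := by
  ext γ
  rw [Subgroup.mem_pointwise_smul_iff_inv_smul_mem, map_inv, inv_inv, MulAut.smul_def, MulAut.conj_apply,
    mem_rightStab_iff, mem_rightStab_iff]
  simp only [← Finset.inv_smul_mem_iff (a := MulOpposite.op g), ← MulOpposite.op_inv, op_smul_eq_mul]
  constructor
  · intro h x
    simpa [mul_assoc] using h (x * g)
  · intro h x
    simpa [mul_assoc] using h (x * g⁻¹)

/-! ## §2 Kida's function `ε` (Definition 2.1, Lemma 2.2) -/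

/-- Kida's function `ε` on pairs of subgroups, as a proposition: `ε(H, K) = 1` iff `HK^g ∌ ρ` for all `g ∈ G`
(`K^g = gKg⁻¹`), i.e. `h·(gkg⁻¹) ≠ ρ` for all `h ∈ H`, `k ∈ K`, `g ∈ G`. [cite: Kida2019CountingCMTypes, Def. 2.1] -/
def Eps (ρ : G) (H K : Subgroup G) : Prop := ∀ g : G, ∀ h ∈ H, ∀ k ∈ K, h * (g * k * g⁻¹) ≠ ρ

namespace Eps

variable {ρ : G} {H K : Subgroup G}

/-- LEMMA 2.2 (i): `ε(H, 1) = 1` for every CM subgroup `H`. [cite: Kida2019CountingCMTypes, Lemma 2.2 (i)] -/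
theorem bot_right (hH : ρ ∉ H) : Eps ρ H ⊥ := by
  intro g h hh k hk
  rw [Subgroup.mem_bot] at hk
  subst hk
  rw [mul_one, mul_inv_cancel, mul_one]
  rintro rfl
  exact hH hh

/-- LEMMA 2.2 (i): `ε(1, K) = 1` for every CM subgroup `K` (`ρ` central). [cite: Kida2019CountingCMTypes, Lemma 2.2 (i)] -/
theorem bot_left (hρc : ∀ g : G, g * ρ = ρ * g) (hK : ρ ∉ K) : Eps ρ ⊥ K := by
  intro g h hh k hk
  rw [Subgroup.mem_bot] at hh
  subst hh
  rw [one_mul]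
  intro hk'
  apply hK
  have : k = ρ := by
    calc k = g⁻¹ * (g * k * g⁻¹) * g := by group
      _ = g⁻¹ * (ρ * g) := by rw [hk', mul_assoc]
      _ = ρ := by rw [← hρc g, inv_mul_cancel_left]
  exact this ▸ hk

/-- LEMMA 2.2 (ii): if `ε(H, K) = 1` then `ε(H₁, K₁) = 1` for all `H₁ ⊆ H`, `K₁ ⊆ K` (contrapositive of the printed
form). [cite: Kida2019CountingCMTypes, Lemma 2.2 (ii)] -/
theorem anti (h : Eps ρ H K) {H₁ K₁ : Subgroup G} (hH : H₁ ≤ H) (hK : K₁ ≤ K) : Eps ρ H₁ K₁ :=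
  fun g a ha k hk => h g a (hH ha) k (hK hk)

/-- LEMMA 2.2 (iii): `ε(H, K) = ε(K, H)` (`ρ` central: `ρ = h k^g` iff `ρ = k h^{g⁻¹}`).
[cite: Kida2019CountingCMTypes, Lemma 2.2 (iii)] -/
theorem symm (hρc : ∀ g : G, g * ρ = ρ * g) (h : Eps ρ H K) : Eps ρ K H := by
  intro g k hk a ha hEq
  -- `k · (g a g⁻¹) = ρ` ⟹ `a · (g⁻¹ k g) = ρ`
  apply h g⁻¹ a ha k hk
  have h1 : g * a * g⁻¹ = k⁻¹ * ρ := by rw [← hEq, inv_mul_cancel_left]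
  have h2 : a = g⁻¹ * k⁻¹ * ρ * g := by
    calc a = g⁻¹ * (g * a * g⁻¹) * g := by group
      _ = g⁻¹ * (k⁻¹ * ρ) * g := by rw [h1]
      _ = g⁻¹ * k⁻¹ * ρ * g := by group
  rw [h2, inv_inv]
  calc g⁻¹ * k⁻¹ * ρ * g * (g⁻¹ * k * g) = g⁻¹ * k⁻¹ * (ρ * k) * g := by group
    _ = g⁻¹ * k⁻¹ * (k * ρ) * g := by rw [hρc k]
    _ = g⁻¹ * (ρ * g) := by group
    _ = g⁻¹ * (g * ρ) := by rw [hρc g]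
    _ = ρ := by rw [inv_mul_cancel_left]

/-- LEMMA 2.2 (iii) as an equivalence. [cite: Kida2019CountingCMTypes, Lemma 2.2 (iii)] -/
theorem comm (hρc : ∀ g : G, g * ρ = ρ * g) : Eps ρ H K ↔ Eps ρ K H := ⟨symm hρc, symm hρc⟩

/-- LEMMA 2.2 (iv): `ε(H, K) = ε(H, K^x)` for all `x ∈ G`. [cite: Kida2019CountingCMTypes, Lemma 2.2 (iv)] -/
theorem conj_right_iff (x : G) : Eps ρ H (MulAut.conj x • K) ↔ Eps ρ H K := by
  constructor
  · intro h g a ha k hk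
    have hk' : x * k * x⁻¹ ∈ MulAut.conj x • K := by
      rw [Subgroup.mem_pointwise_smul_iff_inv_smul_mem, MulAut.smul_def, MulAut.conj_inv_apply]
      have e : x⁻¹ * (x * k * x⁻¹) * x = k := by group
      rw [e]
      exact hk
    have := h (g * x⁻¹) a ha _ hk'
    intro hEq
    apply this
    rw [← hEq]
    group
  · intro h g a ha k hk
    rw [Subgroup.mem_pointwise_smul_iff_inv_smul_mem, MulAut.smul_def, MulAut.conj_inv_apply] at hk
    have := h (g * x) a ha _ hk
    intro hEq
    apply this
    rw [← hEq]
    group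

/-- LEMMA 2.2 (iv), left variable: `ε(H^x, K) = ε(H, K)`. [cite: Kida2019CountingCMTypes, Lemma 2.2 (iii)–(iv)] -/
theorem conj_left_iff (hρc : ∀ g : G, g * ρ = ρ * g) (x : G) : Eps ρ (MulAut.conj x • H) K ↔ Eps ρ H K := by
  rw [comm hρc, conj_right_iff, comm hρc]

/-- `ε(H, K) = 0` as soon as `ρ ∈ H`. [cite: Kida2019CountingCMTypes, Lemma 2.2 (i)–(ii)] -/
theorem rho_not_mem_left (h : Eps ρ H K) : ρ ∉ H := by
  intro hρ
  exact h 1 ρ hρ 1 K.one_mem (by group)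

/-- `ε(H, K) = 0` as soon as `ρ ∈ K` (`ρ` central). [cite: Kida2019CountingCMTypes, Lemma 2.2 (i)–(ii)] -/
theorem rho_not_mem_right (h : Eps ρ H K) : ρ ∉ K := by
  intro hρ
  exact h 1 1 H.one_mem ρ hρ (by group)

end Eps

/-- **`ε` through double cosets** (the mechanism of Lemma 2.3): `ε(K, H) = 1` iff NO double coset `KxH` coincides
with `K(ρx)H` — «if `ε(H,K) = 1`, then both `xᵢ` and `ρxᵢ` cannot belong to a same double coset … Suppose to the
contrary that `HρxᵢK = HxᵢK` … `ρ = hxᵢkxᵢ⁻¹ ∈ HK^{xᵢ}`». [cite: Kida2019CountingCMTypes, Lemma 2.3 (proof)] -/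
theorem eps_iff_forall_doubleCoset_ne {ρ : G} {H K : Subgroup G} :
    Eps ρ K H ↔ ∀ x : G, DoubleCoset.doubleCoset (ρ * x) K H ≠ DoubleCoset.doubleCoset x K H := by
  constructor
  · intro h x hEq
    have hmem : ρ * x ∈ DoubleCoset.doubleCoset x K H := by
      rw [← hEq]; exact DoubleCoset.mem_doubleCoset_self K H (ρ * x)
    obtain ⟨k, hk, a, ha, hka⟩ := DoubleCoset.mem_doubleCoset.1 hmem
    apply h x k hk a ha
    rw [show k * (x * a * x⁻¹) = (k * x * a) * x⁻¹ by group, ← hka, mul_inv_cancel_right]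
  · intro h x k hk a ha hEq
    apply h x
    apply DoubleCoset.doubleCoset_eq_of_mem
    refine DoubleCoset.mem_doubleCoset.2 ⟨k, hk, a, ha, ?_⟩
    rw [← hEq]
    group

/-- The same in the double coset space `K\G/H`: `ε(K, H) = 1` iff `x ↦ ρx` moves every class.
[cite: Kida2019CountingCMTypes, Lemma 2.3 (proof)] -/
theorem eps_iff_forall_mk_ne {ρ : G} {H K : Subgroup G} :
    Eps ρ K H ↔ ∀ x : G, DoubleCoset.mk K H (ρ * x) ≠ DoubleCoset.mk K H x := by
  rw [eps_iff_forall_doubleCoset_ne]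
  refine forall_congr' fun x => ?_
  rw [Ne, Ne, DoubleCoset.eq'']
  rfl



/-! ## §3 Lemma 2.3: counting `X̄(H, K)` by pairs of double cosets -/

/-! ### Half-sets of a fixed-point-free involution (the counting device) -/

section HalfSets

variable {α : Type*} [Fintype α]

/-- The half-sets of a self-map `ι` of a finite type: subsets `T` with `a ∈ T ↔ ι a ∉ T`. [folklore] -/
private def halfSets (ι : α → α) : Finset (Finset α) := Finset.univ.filter fun T => ∀ a, a ∈ T ↔ ι a ∉ T

omit [Fintype α] in
/-- Unfolding `halfSets`. [folklore] -/
private theorem mem_halfSets_iff [Fintype α] {ι : α → α} {T : Finset α} :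
    T ∈ halfSets ι ↔ ∀ a, a ∈ T ↔ ι a ∉ T := by
  simp [halfSets]

/-- An involution with a fixed point has no half-set. [folklore] -/
private theorem halfSets_eq_empty_of_fixed {ι : α → α} {a : α} (ha : ι a = a) : halfSets ι = ∅ := by
  ext T
  simp only [Finset.notMem_empty, iff_false, mem_halfSets_iff]
  intro h
  have h1 := h a
  rw [ha] at h1
  exact iff_not_self h1

/-- A half-set of an involution has half the elements. [folklore] -/
private theorem two_mul_card_of_mem_halfSets {ι : α → α} (hι : Function.Involutive ι) {T : Finset α}
    (hT : T ∈ halfSets ι) : 2 * T.card = Fintype.card α := by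
  rw [mem_halfSets_iff] at hT
  have himg : T.image ι = Finset.univ \ T := by
    ext b
    simp only [Finset.mem_image, Finset.mem_sdiff, Finset.mem_univ, true_and]
    constructor
    · rintro ⟨a, ha, rfl⟩
      exact (hT a).1 ha
    · intro hb
      refine ⟨ι b, ?_, hι b⟩
      have := hT (ι b)
      rw [hι b] at this
      tauto
  have h1 : (T.image ι).card = T.card := Finset.card_image_of_injective _ hι.injective
  have h2 := Finset.card_sdiff_add_card_eq_card (Finset.subset_univ T)
  rw [← himg, h1, Finset.card_univ] at h2
  omega

/-- A fixed-point-free involution of a finite type has a half-set (take the elements that a numbering puts before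
their partners). [folklore] -/
private theorem exists_mem_halfSets {ι : α → α} (hι : Function.Involutive ι) (hfree : ∀ a, ι a ≠ a) :
    ∃ T, T ∈ halfSets ι := by
  let e := Fintype.equivFin α
  refine ⟨Finset.univ.filter fun a => e a < e (ι a), mem_halfSets_iff.2 fun a => ?_⟩
  simp only [Finset.mem_filter, Finset.mem_univ, true_and, hι a, not_lt]
  have hne : e a ≠ e (ι a) := fun h => hfree a (e.injective h).symm
  constructor
  · exact fun h => h.le
  · exact fun h => lt_of_le_of_ne h hne

/-- The half-sets of an involution are in bijection with the subsets of any one of them (`T ↦ T ∩ T₀`).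
[folklore] -/
private theorem card_halfSets_eq_two_pow_card {ι : α → α} (hι : Function.Involutive ι) {T₀ : Finset α}
    (h₀ : T₀ ∈ halfSets ι) : (halfSets ι).card = 2 ^ T₀.card := by
  have h₀' := mem_halfSets_iff.1 h₀
  rw [← Finset.card_powerset]
  refine Finset.card_bij' (fun T _ => T ∩ T₀)
    (fun U _ => Finset.univ.filter fun a => (a ∈ T₀ ∧ a ∈ U) ∨ (a ∉ T₀ ∧ ι a ∉ U)) ?_ ?_ ?_ ?_
  · intro T _
    exact Finset.mem_powerset.2 Finset.inter_subset_right
  · intro U hU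
    rw [Finset.mem_powerset] at hU
    rw [mem_halfSets_iff]
    intro a
    simp only [Finset.mem_filter, Finset.mem_univ, true_and, hι a]
    by_cases ha : a ∈ T₀
    · have hιa : ι a ∉ T₀ := (h₀' a).1 ha
      tauto
    · have hιa : ι a ∈ T₀ := by have := h₀' a; tauto
      have : a ∉ U := fun h => ha (hU h)
      tauto
  · intro T hT
    rw [mem_halfSets_iff] at hT
    ext a
    simp only [Finset.mem_filter, Finset.mem_univ, true_and, Finset.mem_inter]
    by_cases ha : a ∈ T₀
    · tauto
    · have hιa : ι a ∈ T₀ := by have := h₀' a; tauto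
      have := hT a
      tauto
  · intro U hU
    rw [Finset.mem_powerset] at hU
    ext a
    simp only [Finset.mem_inter, Finset.mem_filter, Finset.mem_univ, true_and]
    constructor
    · rintro ⟨h | h, ha⟩
      · exact h.2
      · exact absurd ha h.1
    · intro h
      exact ⟨Or.inl ⟨hU h, h⟩, hU h⟩

/-- **The number of half-sets of a fixed-point-free involution of a finite type is `2^{|α|/2}`.** [folklore] -/
private theorem card_halfSets {ι : α → α} (hι : Function.Involutive ι) (hfree : ∀ a, ι a ≠ a) :
    (halfSets ι).card = 2 ^ (Fintype.card α / 2) := by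
  obtain ⟨T₀, h₀⟩ := exists_mem_halfSets hι hfree
  rw [card_halfSets_eq_two_pow_card hι h₀, ← two_mul_card_of_mem_halfSets hι h₀]
  congr 1
  omega

/-- The underlying type of a fixed-point-free involution with a half-set has even cardinality. [folklore] -/
private theorem even_card_of_involutive {ι : α → α} (hι : Function.Involutive ι) (hfree : ∀ a, ι a ≠ a) :
    Even (Fintype.card α) := by
  obtain ⟨T₀, h₀⟩ := exists_mem_halfSets hι hfree
  exact ⟨T₀.card, by have := two_mul_card_of_mem_halfSets hι h₀; omega⟩

end HalfSets

/-! ### The involution `KxH ↦ KρxH` of `K\G/H` and Lemma 2.3 -/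

/-- The double coset space `K\G/H` of a finite group is finite. [folklore] -/
private instance finite_doubleCosetQuotient [Finite G] (K H : Subgroup G) :
    Finite (DoubleCoset.Quotient (K : Set G) H) :=
  Quotient.finite (DoubleCoset.setoid (K : Set G) H)

/-- The double coset space `K\G/H` of a finite group as a finite type (classical enumeration), so that its subsets
form a `Finset` universe. [cite: Kida2019CountingCMTypes, Lemma 2.3] -/
instance fintypeDoubleCosetQuotient [Finite G] (K H : Subgroup G) : Fintype (DoubleCoset.Quotient (K : Set G) H) :=
  Fintype.ofFinite _

/-- `|1\G/H| = (G : H)`: double cosets by the trivial subgroup are left cosets. [folklore] -/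
private theorem natCard_doubleCosetQuotient_bot (H : Subgroup G) :
    Nat.card (DoubleCoset.Quotient ((⊥ : Subgroup G) : Set G) H) = H.index := by
  rw [Subgroup.index_eq_card]
  exact Nat.card_congr (Quotient.congrRight fun a b =>
    iff_of_eq (congrFun (congrFun (DoubleCoset.bot_rel_eq_leftRel H) a) b))

/-- The self-map `KxH ↦ K(ρx)H` of the double coset space `K\G/H` (on representatives; well defined because `ρ` is
central, `doubleCosetRho_mk`) — the pairing `(HxᵢK, HρxᵢK)` of (2-4). [cite: Kida2019CountingCMTypes, Lemma 2.3 (proof, (2-4))] -/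
def doubleCosetRho (ρ : G) (K H : Subgroup G) (q : DoubleCoset.Quotient (K : Set G) H) :
    DoubleCoset.Quotient (K : Set G) H :=
  DoubleCoset.mk K H (ρ * q.out)

variable {ρ : G}

/-- `K(ρ·)H` on classes: `doubleCosetRho (KxH) = K(ρx)H` (`ρ` central). [cite: Kida2019CountingCMTypes, Lemma 2.3 (proof)] -/
theorem doubleCosetRho_mk (hρc : ∀ g : G, g * ρ = ρ * g) (K H : Subgroup G) (x : G) :
    doubleCosetRho ρ K H (DoubleCoset.mk K H x) = DoubleCoset.mk K H (ρ * x) := by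
  unfold doubleCosetRho
  obtain ⟨k, h, hk, hh, hEq⟩ := DoubleCoset.mk_out_eq_mul K H x
  rw [hEq, DoubleCoset.eq]
  refine ⟨k⁻¹, K.inv_mem hk, h⁻¹, H.inv_mem hh, ?_⟩
  rw [show ρ * (k * x * h) = (ρ * k) * (x * h) by group, ← hρc k]
  group

/-- `doubleCosetRho` is an involution (`ρ² = 1`). [cite: Kida2019CountingCMTypes, Lemma 2.3 (proof)] -/
theorem doubleCosetRho_involutive (hρc : ∀ g : G, g * ρ = ρ * g) (hρ2 : ρ * ρ = 1) (K H : Subgroup G) :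
    Function.Involutive (doubleCosetRho ρ K H) := by
  intro q
  induction q using Quotient.inductionOn with
  | h x =>
    change doubleCosetRho ρ K H (doubleCosetRho ρ K H (DoubleCoset.mk K H x)) = DoubleCoset.mk K H x
    rw [doubleCosetRho_mk hρc, doubleCosetRho_mk hρc, ← mul_assoc, hρ2, one_mul]

/-- `ε(K, H) = 1` iff `doubleCosetRho` has no fixed point. [cite: Kida2019CountingCMTypes, Lemma 2.3 (proof)] -/
theorem eps_iff_forall_doubleCosetRho_ne (hρc : ∀ g : G, g * ρ = ρ * g) {H K : Subgroup G} :
    Eps ρ K H ↔ ∀ q, doubleCosetRho ρ K H q ≠ q := by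
  rw [eps_iff_forall_mk_ne]
  constructor
  · intro h q
    induction q using Quotient.inductionOn with
    | h x =>
      change doubleCosetRho ρ K H (DoubleCoset.mk K H x) ≠ DoubleCoset.mk K H x
      rw [doubleCosetRho_mk hρc]
      exact h x
  · intro h x
    rw [← doubleCosetRho_mk hρc]
    exact h _

section Finite

variable [Fintype G]

/-- A member of `X̄(H, K)` is a union of double cosets `KxH` («if `S ∈ X̄(H,K)`, then we have a double coset
decomposition `S = Hx₁K ⊔ ⋯ ⊔ HxᵣK`»). [cite: Kida2019CountingCMTypes, Lemma 2.3 (proof)] -/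
theorem mem_iff_mem_of_mk_eq {H K : Subgroup G} {S : Finset G} (hS : S ∈ Xbar ρ H K) {x y : G}
    (hxy : DoubleCoset.mk K H x = DoubleCoset.mk K H y) : x ∈ S ↔ y ∈ S := by
  rw [mem_Xbar] at hS
  obtain ⟨-, hH, hK⟩ := hS
  obtain ⟨k, hk, h, hh, rfl⟩ := (DoubleCoset.eq K H x y).1 hxy
  rw [mem_rightStab_iff.1 (hH hh), mem_leftStab_iff.1 (hK hk)]

/-- The half-set of `K\G/H` attached to `S ∈ X̄(H, K)`: the classes contained in `S`. [cite: Kida2019CountingCMTypes, Lemma 2.3 (proof)] -/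
private def toClasses (H K : Subgroup G) (S : Finset G) : Finset (DoubleCoset.Quotient (K : Set G) H) :=
  Finset.univ.filter fun q => q.out ∈ S

/-- The union of the double cosets in a set of classes. [cite: Kida2019CountingCMTypes, Lemma 2.3 (proof)] -/
private def ofClasses (H K : Subgroup G) (T : Finset (DoubleCoset.Quotient (K : Set G) H)) : Finset G :=
  Finset.univ.filter fun x => DoubleCoset.mk K H x ∈ T

/-- **LEMMA 2.3 (the bijection).** `X̄(H, K)` is in bijection with the half-sets of the involution `KxH ↦ KρxH` of
`K\G/H` («by choosing one double coset from each pair of cosets `(HxᵢK, HρxᵢK)`, we can form a CM-type `S` such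
that `s(S) ⊃ H` and `r(S) ⊃ K` … a one-to-one correspondence»). [cite: Kida2019CountingCMTypes, Lemma 2.3] -/
theorem card_Xbar_eq_card_halfSets (hρc : ∀ g : G, g * ρ = ρ * g) (hρ2 : ρ * ρ = 1) (H K : Subgroup G) :
    (Xbar ρ H K).card = (halfSets (doubleCosetRho ρ K H)).card := by
  refine Finset.card_bij' (fun S _ => toClasses H K S) (fun T _ => ofClasses H K T) ?_ ?_ ?_ ?_
  · intro S hS
    rw [mem_halfSets_iff]
    intro q
    simp only [toClasses, Finset.mem_filter, Finset.mem_univ, true_and]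
    have h1 : DoubleCoset.mk K H (doubleCosetRho ρ K H q).out = DoubleCoset.mk K H (ρ * q.out) := by
      rw [DoubleCoset.out_eq']; rfl
    rw [mem_iff_mem_of_mk_eq hS h1, ((mem_Xbar.1 hS).1.rho_mul_mem_iff hρ2), not_not]
  · intro T hT
    rw [mem_halfSets_iff] at hT
    rw [mem_Xbar]
    refine ⟨fun x => ?_, fun h hh => mem_rightStab_iff.2 fun x => ?_, fun k hk => mem_leftStab_iff.2 fun x => ?_⟩
    · simp only [ofClasses, Finset.mem_filter, Finset.mem_univ, true_and]
      rw [← doubleCosetRho_mk hρc]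
      exact hT _
    · simp only [ofClasses, Finset.mem_filter, Finset.mem_univ, true_and]
      rw [(DoubleCoset.eq K H (x * h) x).2 ⟨1, K.one_mem, h⁻¹, H.inv_mem hh, by group⟩]
    · simp only [ofClasses, Finset.mem_filter, Finset.mem_univ, true_and]
      rw [(DoubleCoset.eq K H (k * x) x).2 ⟨k⁻¹, K.inv_mem hk, 1, H.one_mem, by group⟩]
  · intro S hS
    ext x
    simp only [ofClasses, toClasses, Finset.mem_filter, Finset.mem_univ, true_and]
    exact mem_iff_mem_of_mk_eq hS (DoubleCoset.out_eq' K H _)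
  · intro T _
    ext q
    simp only [ofClasses, toClasses, Finset.mem_filter, Finset.mem_univ, true_and, DoubleCoset.out_eq']

/-- If `ε(H, K) = 0` then `X̄(H, K) = ∅` («the double coset decomposition of the form (2-4) is obviously impossible.
Thus there is no CM-type satisfying the conditions»). [cite: Kida2019CountingCMTypes, Lemma 2.3] -/
theorem Xbar_eq_empty_of_not_eps (hρc : ∀ g : G, g * ρ = ρ * g) (hρ2 : ρ * ρ = 1) {H K : Subgroup G}
    (h : ¬ Eps ρ H K) : Xbar ρ H K = ∅ := by
  rw [Eps.comm hρc, eps_iff_forall_doubleCosetRho_ne hρc] at h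
  obtain ⟨q, hq⟩ := not_forall.1 h
  rw [not_ne_iff] at hq
  rw [← Finset.card_eq_zero, card_Xbar_eq_card_halfSets hρc hρ2, halfSets_eq_empty_of_fixed hq,
    Finset.card_empty]

/-- **LEMMA 2.3.** `|X̄(H, K)| = ε(H, K)·2^{½|K\G/H|}` — «`= 0` if `ε(K, H) = 0`; `2^{½|H\G/K|}` otherwise» (Kida's
`H\G/K` is the tree's `K\G/H` under `S ↦ S⁻¹`; the two double coset spaces are in bijection by `x ↦ x⁻¹`).
[cite: Kida2019CountingCMTypes, Lemma 2.3] -/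
theorem card_Xbar (hρc : ∀ g : G, g * ρ = ρ * g) (hρ2 : ρ * ρ = 1) (H K : Subgroup G) :
    (Xbar ρ H K).card =
      if Eps ρ H K then 2 ^ (Nat.card (DoubleCoset.Quotient (K : Set G) H) / 2) else 0 := by
  split_ifs with h
  · rw [card_Xbar_eq_card_halfSets hρc hρ2, Nat.card_eq_fintype_card]
    exact card_halfSets (doubleCosetRho_involutive hρc hρ2 K H)
      ((eps_iff_forall_doubleCosetRho_ne hρc).1 ((Eps.comm hρc).1 h))
  · rw [Xbar_eq_empty_of_not_eps hρc hρ2 h, Finset.card_empty]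

/-- Under `ε(H, K) = 1` the number of double cosets `|K\G/H|` is EVEN («`G = Hx₁K ⊔ ⋯ ⊔ HxᵣK ⊔ Hρx₁K ⊔ ⋯ ⊔ HρxᵣK`
and hence we have `2r = |H\G/K|`»). [cite: Kida2019CountingCMTypes, Lemma 2.3 (2-4)] -/
theorem even_natCard_doubleCosetQuotient (hρc : ∀ g : G, g * ρ = ρ * g) (hρ2 : ρ * ρ = 1) {H K : Subgroup G}
    (h : Eps ρ H K) : Even (Nat.card (DoubleCoset.Quotient (K : Set G) H)) := by
  rw [Nat.card_eq_fintype_card]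
  exact even_card_of_involutive (doubleCosetRho_involutive hρc hρ2 K H)
    ((eps_iff_forall_doubleCosetRho_ne hρc).1 ((Eps.comm hρc).1 h))

/-- `X̄(H, K)` is non-empty iff `ε(H, K) = 1`. [cite: Kida2019CountingCMTypes, Lemma 2.3] -/
theorem Xbar_nonempty_iff (hρc : ∀ g : G, g * ρ = ρ * g) (hρ2 : ρ * ρ = 1) {H K : Subgroup G} :
    (Xbar ρ H K).Nonempty ↔ Eps ρ H K := by
  rw [← Finset.card_pos, card_Xbar hρc hρ2]
  split_ifs with h
  · simp [h]
  · simp [h]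

/-! ### Special cases: `|CM(G, H, ρ)| = 2^{½(G:H)}` and the number of all half-systems -/

/-- `CM(G, H, ρ) = X̄(H, 1)`. [cite: Kida2019CountingCMTypes, §3 (proof of Prop. 3.1)] -/
theorem cmTypes_eq_Xbar_bot (H : Subgroup G) : cmTypes ρ H = Xbar ρ H ⊥ := by
  ext S
  simp

/-- **`|CM(G, H, ρ)| = 2^{½|H\G|}`** for a CM subgroup `H` («`|𝒮̄(H)| = |π_H⁻¹(CM(G, H, ρ))| = |CM(G, H, ρ)| =
2^{½|H\G|}`»), and `= 0` if `ρ ∈ H`. [cite: Kida2019CountingCMTypes, Prop. 3.1 (proof)] -/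
theorem card_cmTypes (hρc : ∀ g : G, g * ρ = ρ * g) (hρ2 : ρ * ρ = 1) (H : Subgroup G) :
    (cmTypes ρ H).card = if ρ ∈ H then 0 else 2 ^ (H.index / 2) := by
  rw [cmTypes_eq_Xbar_bot, card_Xbar hρc hρ2, natCard_doubleCosetQuotient_bot]
  by_cases h : ρ ∈ H
  · rw [if_neg (fun hε : Eps ρ H ⊥ => hε.rho_not_mem_left h), if_pos h]
  · rw [if_pos (Eps.bot_right h), if_neg h]

/-- `(G : H)` is even for a CM subgroup `H` of a group with a half-system count (`ρ ∉ H`, `ρ` central involution):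
«we have `|Φ_M| = 2d`». [cite: Kida2019CountingCMTypes, §1] -/
theorem even_index (hρc : ∀ g : G, g * ρ = ρ * g) (hρ2 : ρ * ρ = 1) {H : Subgroup G} (hH : ρ ∉ H) :
    Even H.index := by
  rw [← natCard_doubleCosetQuotient_bot]
  exact even_natCard_doubleCosetQuotient hρc hρ2 (Eps.bot_right hH)

/-- All half-systems: `CM(G, 1, ρ) = halfSystems ρ`. [cite: Kida2019CountingCMTypes, §1] -/
theorem cmTypes_bot : cmTypes ρ (⊥ : Subgroup G) = halfSystems ρ := by
  ext S
  simp

/-- **There are `2^{|G|/2}` half-systems** of `(G, ρ)` for a central involution `ρ ≠ 1` (the CM types of the Galois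
CM field `L` itself). [cite: Kida2019CountingCMTypes, Prop. 3.1 (proof)] -/
theorem card_halfSystems (hρc : ∀ g : G, g * ρ = ρ * g) (hρ2 : ρ * ρ = 1) (hρ1 : ρ ≠ 1) :
    (halfSystems ρ).card = 2 ^ (Fintype.card G / 2) := by
  rw [← cmTypes_bot, card_cmTypes hρc hρ2, if_neg (by rwa [Subgroup.mem_bot]), Subgroup.index_bot,
    Nat.card_eq_fintype_card]

end Finite


/-! ## §4 Möbius inversion: Theorem 2.4, Proposition 3.1, Proposition 3.3 and their corollaries -/

/-- For a finite group the lattice of subgroups is a locally finite order, so that Mathlib's Möbius function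
`IncidenceAlgebra.mu` of [Rota1964] is available on it; Kida's poset `𝓗` of CM subgroups is a LOWER set of this
lattice (`K ≤ H ∌ ρ ⟹ ρ ∉ K`), hence its intervals — and its Möbius function (1-5) — are those of `Subgroup G`.
[cite: Kida2019CountingCMTypes, §1 (1-4)–(1-5)] -/
instance (priority := low) instLocallyFiniteOrderSubgroup [Finite G] : LocallyFiniteOrder (Subgroup G) :=
  LocallyFiniteOrder.ofFiniteIcc fun _ _ => Set.toFinite _

open IncidenceAlgebra

section Moebius

variable [Fintype G]

/-- **Kida's Möbius function is Mathlib's**: `μ(H₁, H₁) = 1` and `μ(H₁, H₂) = −Σ_{H₁ ≤ H < H₂} μ(H₁, H)` (1-5).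
[cite: Kida2019CountingCMTypes, §1 (1-5)] -/
theorem mu_eq (H₁ H₂ : Subgroup G) :
    mu ℤ H₁ H₂ = if H₁ = H₂ then 1 else -∑ H ∈ Finset.Ico H₁ H₂, mu ℤ H₁ H := mu_apply H₁ H₂

/-! ### Theorem 2.4 (the fundamental formula) -/

/-- `X̄(H, K) = ⨆_{(H₁,K₁) ≥ (H,K)} X(H₁, K₁)` (2-3), a disjoint union. [cite: Kida2019CountingCMTypes, §2 (2-3)] -/
theorem Xbar_eq_biUnion (H K : Subgroup G) :
    Xbar ρ H K = (Finset.Ici (H, K)).biUnion fun p => X ρ p.1 p.2 := by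
  ext S
  simp only [mem_Xbar, Finset.mem_biUnion, Finset.mem_Ici, mem_X, Prod.exists, Prod.mk_le_mk]
  constructor
  · rintro ⟨hS, hH, hK⟩
    exact ⟨rightStab S, leftStab S, ⟨hH, hK⟩, hS, rfl, rfl⟩
  · rintro ⟨H₁, K₁, ⟨hH, hK⟩, hS, rfl, rfl⟩
    exact ⟨hS, hH, hK⟩

/-- `|X̄(H, K)| = Σ_{(H₁,K₁) ≥ (H,K)} |X(H₁, K₁)|` (the sets `X(H₁, K₁)` are pairwise disjoint).
[cite: Kida2019CountingCMTypes, §2 (2-3)] -/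
theorem card_Xbar_eq_sum_card_X (H K : Subgroup G) :
    (Xbar ρ H K).card = ∑ p ∈ Finset.Ici (H, K), (X ρ p.1 p.2).card := by
  rw [Xbar_eq_biUnion, Finset.card_biUnion]
  intro p _ q _ hpq
  rw [Function.onFun, Finset.disjoint_left]
  intro S hp hq
  rw [mem_X] at hp hq
  exact hpq (Prod.ext (hp.2.1.symm.trans hq.2.1) (hp.2.2.symm.trans hq.2.2))

/-- THEOREM 2.4, Möbius form: `|X(H, K)| = Σ_{(H₁,K₁) ≥ (H,K)} μ((H,K),(H₁,K₁))·|X̄(H₁, K₁)|` (Möbius inversion on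
the product poset, [Rota 1964, Prop. 3]). [cite: Kida2019CountingCMTypes, Thm. 2.4 (proof)] -/
theorem card_X_eq_sum_mu_mul_card_Xbar (H K : Subgroup G) :
    ((X ρ H K).card : ℤ) = ∑ p ∈ Finset.Ici (H, K), mu ℤ (H, K) p * (Xbar ρ p.1 p.2).card :=
  moebius_inversion_top (𝕜 := ℤ) (α := Subgroup G × Subgroup G)
    (fun p => ((X ρ p.1 p.2).card : ℤ)) (fun p => ((Xbar ρ p.1 p.2).card : ℤ))
    (fun p => by rw [card_Xbar_eq_sum_card_X]; push_cast; rfl) (H, K)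

/-- The Möbius function of a product poset is the product of the Möbius functions ([Rota 1964, Prop. 5]; Mathlib
`IncidenceAlgebra.mu_prod_mu`). [cite: Kida2019CountingCMTypes, Thm. 2.4 (proof)] -/
theorem mu_prod_eq (p q : Subgroup G × Subgroup G) : mu ℤ p q = mu ℤ p.1 q.1 * mu ℤ p.2 q.2 := by
  rw [← mu_prod_mu]
  rfl

/-- **THEOREM 2.4 (Kida's fundamental formula).**
`|X(H, K)| = Σ_{H₁ ⊇ H} Σ_{K₁ ⊇ K} ε(H₁, K₁)·μ(H, H₁)·μ(K, K₁)·2^{½|K₁\G/H₁|}` — the number of CM types with field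
subgroup exactly `H` (simple for `(G, H, ρ)`) and reflex subgroup exactly `K`. [cite: Kida2019CountingCMTypes, Thm. 2.4] -/
theorem card_X_eq_sum (hρc : ∀ g : G, g * ρ = ρ * g) (hρ2 : ρ * ρ = 1) (H K : Subgroup G) :
    ((X ρ H K).card : ℤ) = ∑ p ∈ Finset.Ici (H, K),
      if Eps ρ p.1 p.2 then mu ℤ H p.1 * mu ℤ K p.2 * 2 ^ (Nat.card (DoubleCoset.Quotient (p.2 : Set G) p.1) / 2)
      else 0 := by
  rw [card_X_eq_sum_mu_mul_card_Xbar]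
  refine Finset.sum_congr rfl fun p _ => ?_
  rw [mu_prod_eq, card_Xbar hρc hρ2]
  split_ifs <;> simp

/-- THEOREM 2.4 with Kida's range of summation `H₁ ∈ 𝓗(H)`, `K₁ ∈ 𝓗(K)` (CM subgroups only: the other terms vanish
because `ε(H₁, K₁) = 0` as soon as `ρ ∈ H₁` or `ρ ∈ K₁`). [cite: Kida2019CountingCMTypes, Thm. 2.4] -/
theorem card_X_eq_sum_cmSubgroups (hρc : ∀ g : G, g * ρ = ρ * g) (hρ2 : ρ * ρ = 1) (H K : Subgroup G) :
    ((X ρ H K).card : ℤ) = ∑ p ∈ (Finset.Ici (H, K)).filter (fun p => ρ ∉ p.1 ∧ ρ ∉ p.2),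
      if Eps ρ p.1 p.2 then mu ℤ H p.1 * mu ℤ K p.2 * 2 ^ (Nat.card (DoubleCoset.Quotient (p.2 : Set G) p.1) / 2)
      else 0 := by
  rw [card_X_eq_sum hρc hρ2, Finset.sum_filter]
  refine Finset.sum_congr rfl fun p _ => ?_
  by_cases h : Eps ρ p.1 p.2
  · have h' : ρ ∉ p.1 ∧ ρ ∉ p.2 := ⟨h.rho_not_mem_left, h.rho_not_mem_right⟩
    rw [if_pos h']
  · simp [if_neg h]

/-! ### Corollary 2.5 and Corollary 2.8 by explicit bijections -/

/-- COROLLARY 2.5: `|X(H, K)| = |X(K, H)|` — here by the bijection `S ↦ S⁻¹`, which exchanges the two stabilisers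
(Kida derives it from the symmetry of Theorem 2.4 and of `ε`). [cite: Kida2019CountingCMTypes, Cor. 2.5] -/
theorem card_X_symm (hρc : ∀ g : G, g * ρ = ρ * g) (hρ2 : ρ * ρ = 1) (H K : Subgroup G) :
    (X ρ H K).card = (X ρ K H).card := by
  refine Finset.card_bij' (fun S _ => S⁻¹) (fun S _ => S⁻¹) ?_ ?_ (fun S _ => inv_inv S) (fun S _ => inv_inv S)
  · intro S hS
    rw [mem_X] at hS ⊢
    exact ⟨hS.1.inv hρc hρ2, by rw [rightStab_inv, hS.2.2], by rw [leftStab_inv, hS.2.1]⟩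
  · intro S hS
    rw [mem_X] at hS ⊢
    exact ⟨hS.1.inv hρc hρ2, by rw [rightStab_inv, hS.2.2], by rw [leftStab_inv, hS.2.1]⟩

/-- COROLLARY 2.8: `|X(H, K)| = |X(Hˣ, Kʸ)|` for all `x, y ∈ G` — here by the bijection `S ↦ y·S·x⁻¹`.
[cite: Kida2019CountingCMTypes, Cor. 2.8] -/
theorem card_X_conj (hρc : ∀ g : G, g * ρ = ρ * g) (H K : Subgroup G) (x y : G) :
    (X ρ (MulAut.conj x • H) (MulAut.conj y • K)).card = (X ρ H K).card := by
  symm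
  refine Finset.card_bij' (fun S _ => y • (MulOpposite.op x⁻¹ • S)) (fun T _ => MulOpposite.op x • (y⁻¹ • T))
    ?_ ?_ ?_ ?_
  · intro S hS
    rw [mem_X] at hS ⊢
    refine ⟨(hS.1.op_smul x⁻¹).smul hρc y, ?_, ?_⟩
    · rw [rightStab_smul, rightStab_op_smul, inv_inv, hS.2.1]
    · rw [leftStab_smul, leftStab_op_smul, hS.2.2]
  · intro T hT
    rw [mem_X] at hT ⊢
    refine ⟨(hT.1.smul hρc y⁻¹).op_smul x, ?_, ?_⟩
    · rw [rightStab_op_smul, rightStab_smul, hT.2.1, smul_smul, ← map_mul, inv_mul_cancel, map_one, one_smul]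
    · rw [leftStab_op_smul, leftStab_smul, hT.2.2, smul_smul, ← map_mul, inv_mul_cancel, map_one, one_smul]
  · intro S _
    rw [inv_smul_smul, MulOpposite.op_inv, smul_inv_smul]
  · intro T _
    rw [MulOpposite.op_inv, inv_smul_smul, smul_inv_smul]

/-! ### Corollaries 2.6 and 2.7 (normal subgroups) -/

omit [Fintype G] in
/-- A NORMAL subgroup of the right stabiliser lies in the left stabiliser: for `H ⊴ G`, `S·H = S` implies `H·S = S`
(«the double coset decomposition (2-4) agrees with the left coset decomposition by `HK`»).
[cite: Kida2019CountingCMTypes, Cor. 2.6 (proof)] -/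
theorem le_leftStab_of_normal {H : Subgroup G} (hH : H.Normal) {S : Finset G} (h : H ≤ rightStab S) :
    H ≤ leftStab S := by
  intro g hg
  rw [mem_leftStab_iff]
  intro x
  have h1 : x⁻¹ * g * x ∈ H := by
    have := hH.conj_mem g hg x⁻¹
    rwa [inv_inv] at this
  have h2 := mem_rightStab_iff.1 (h h1) x
  rwa [← mul_assoc, ← mul_assoc, mul_inv_cancel, one_mul] at h2

/-- COROLLARY 2.6 (ii): for `H` normal, `X(H, K) = ∅` unless `H ⊆ K` («if `HK ⊋ K`, then `X(H, K) = ∅`»: the reflex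
subgroup of a CM type of the GALOIS CM field `L^H` contains `H`, i.e. the reflex field lies in `L^H`).
[cite: Kida2019CountingCMTypes, Cor. 2.6 (ii)] -/
theorem X_eq_empty_of_normal_of_not_le {H K : Subgroup G} (hH : H.Normal) (h : ¬ H ≤ K) : X ρ H K = ∅ := by
  rw [Finset.eq_empty_iff_forall_notMem]
  intro S hS
  rw [mem_X] at hS
  exact h (hS.2.2 ▸ le_leftStab_of_normal hH hS.2.1.ge)

/-- COROLLARY 2.6 (i): for `H` normal and `K ⊆ H`, `X(H, K) ≠ ∅` only if `K = H` (the printed «if and only if» holds in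
this direction; for the converse one needs a simple type to exist, cf. Lemma 6.1). [cite: Kida2019CountingCMTypes, Cor. 2.6 (i)] -/
theorem eq_of_normal_of_X_nonempty {H K : Subgroup G} (hH : H.Normal) (hKH : K ≤ H) (h : (X ρ H K).Nonempty) :
    K = H := by
  refine le_antisymm hKH ?_
  by_contra hHK
  rw [X_eq_empty_of_normal_of_not_le hH hHK] at h
  exact Finset.not_nonempty_empty h

/-- **COROLLARY 2.7**: if `H` and `K` are both normal and `H ≠ K` then `X(H, K) = ∅` — «in particular, if all CM
subgroups of `G` are normal, then the matrix `(|X(H, K)|)_{H,K ∈ 𝓗}` is diagonal».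
[cite: Kida2019CountingCMTypes, Cor. 2.7] -/
theorem X_eq_empty_of_normal_of_ne (hρc : ∀ g : G, g * ρ = ρ * g) (hρ2 : ρ * ρ = 1) {H K : Subgroup G}
    (hH : H.Normal) (hK : K.Normal) (hne : H ≠ K) : X ρ H K = ∅ := by
  by_contra hX
  have h1 : H ≤ K := by
    by_contra h
    exact hX (X_eq_empty_of_normal_of_not_le hH h)
  have h2 : K ≤ H := by
    by_contra h
    have := X_eq_empty_of_normal_of_not_le (ρ := ρ) hK h
    rw [← Finset.card_eq_zero, ← card_X_symm hρc hρ2, Finset.card_eq_zero] at this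
    exact hX this
  exact hne (le_antisymm h1 h2)

/-! ### Proposition 3.1 (the number of simple CM types) and Corollary 3.2 -/

/-- `𝒮̄(H) = ⨆_{N ⊇ H} 𝒮(N)`, a disjoint union. [cite: Kida2019CountingCMTypes, Prop. 3.1 (proof)] -/
theorem cmTypes_eq_biUnion (H : Subgroup G) :
    cmTypes ρ H = (Finset.Ici H).biUnion fun N => simpleTypes ρ N := by
  ext S
  simp only [mem_cmTypes, Finset.mem_biUnion, Finset.mem_Ici, mem_simpleTypes]
  constructor
  · rintro ⟨hS, hH⟩
    exact ⟨rightStab S, hH, hS, rfl⟩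
  · rintro ⟨N, hN, hS, rfl⟩
    exact ⟨hS, hN⟩

/-- `|𝒮̄(H)| = Σ_{N ⊇ H} |𝒮(N)|`. [cite: Kida2019CountingCMTypes, Prop. 3.1 (proof)] -/
theorem card_cmTypes_eq_sum_card_simpleTypes (H : Subgroup G) :
    (cmTypes ρ H).card = ∑ N ∈ Finset.Ici H, (simpleTypes ρ N).card := by
  rw [cmTypes_eq_biUnion, Finset.card_biUnion]
  intro p _ q _ hpq
  rw [Function.onFun, Finset.disjoint_left]
  intro S hp hq
  rw [mem_simpleTypes] at hp hq
  exact hpq (hp.2.symm.trans hq.2)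

/-- PROPOSITION 3.1, Möbius form: `|𝒮(H)| = Σ_{N ⊇ H} μ(H, N)·|𝒮̄(N)|`. [cite: Kida2019CountingCMTypes, Prop. 3.1 (proof)] -/
theorem card_simpleTypes_eq_sum_mu_mul_card_cmTypes (H : Subgroup G) :
    ((simpleTypes ρ H).card : ℤ) = ∑ N ∈ Finset.Ici H, mu ℤ H N * (cmTypes ρ N).card :=
  moebius_inversion_top (𝕜 := ℤ) (α := Subgroup G) (fun N => ((simpleTypes ρ N).card : ℤ))
    (fun N => ((cmTypes ρ N).card : ℤ)) (fun N => by rw [card_cmTypes_eq_sum_card_simpleTypes]; push_cast; rfl) H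

/-- **PROPOSITION 3.1 (the number of simple CM types).**  `|𝒮(H)| = Σ_{N ∈ 𝓗(H)} μ(H, N)·2^{½|N\G|}`, the sum over
the CM subgroups `N ⊇ H` — the number of PRIMITIVE CM types of the CM field `L^H` (Schmidt/Shimura: right
stabiliser exactly `H`). [cite: Kida2019CountingCMTypes, Prop. 3.1] -/
theorem card_simpleTypes_eq_sum (hρc : ∀ g : G, g * ρ = ρ * g) (hρ2 : ρ * ρ = 1) (H : Subgroup G) :
    ((simpleTypes ρ H).card : ℤ) =
      ∑ N ∈ (Finset.Ici H).filter (fun N => ρ ∉ N), mu ℤ H N * 2 ^ (N.index / 2) := by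
  rw [card_simpleTypes_eq_sum_mu_mul_card_cmTypes, Finset.sum_filter]
  refine Finset.sum_congr rfl fun N _ => ?_
  rw [card_cmTypes hρc hρ2]
  split_ifs <;> simp

/-- **COROLLARY 3.2**: `|ℛ(H)| = |𝒮(H)|` — the number of half-systems with REFLEX subgroup exactly `H` equals the
number with field subgroup exactly `H` (here by `S ↦ S⁻¹`; Kida: from Cor. 2.5), hence is given by Prop. 3.1.
[cite: Kida2019CountingCMTypes, Cor. 3.2] -/
theorem card_reflexTypes_eq_card_simpleTypes (hρc : ∀ g : G, g * ρ = ρ * g) (hρ2 : ρ * ρ = 1) (H : Subgroup G) :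
    (reflexTypes ρ H).card = (simpleTypes ρ H).card := by
  refine Finset.card_bij' (fun S _ => S⁻¹) (fun S _ => S⁻¹) ?_ ?_ (fun S _ => inv_inv S) (fun S _ => inv_inv S)
  · intro S hS
    rw [mem_reflexTypes] at hS
    rw [mem_simpleTypes]
    exact ⟨hS.1.inv hρc hρ2, by rw [rightStab_inv, hS.2]⟩
  · intro S hS
    rw [mem_simpleTypes] at hS
    rw [mem_reflexTypes]
    exact ⟨hS.1.inv hρc hρ2, by rw [leftStab_inv, hS.2]⟩

/-- COROLLARY 3.2, explicit: `|ℛ(H)| = Σ_{N ∈ 𝓗(H)} μ(H, N)·2^{½|N\G|}`. [cite: Kida2019CountingCMTypes, Cor. 3.2] -/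
theorem card_reflexTypes_eq_sum (hρc : ∀ g : G, g * ρ = ρ * g) (hρ2 : ρ * ρ = 1) (H : Subgroup G) :
    ((reflexTypes ρ H).card : ℤ) =
      ∑ N ∈ (Finset.Ici H).filter (fun N => ρ ∉ N), mu ℤ H N * 2 ^ (N.index / 2) := by
  rw [card_reflexTypes_eq_card_simpleTypes hρc hρ2, card_simpleTypes_eq_sum hρc hρ2]

/-- The same count for `ℛ̄(K)` as for `𝒮̄(K)`: `|ℛ̄(K)| = |CM(G, K, ρ)|` (by `S ↦ S⁻¹`), `= 2^{½(G:K)}` for a CM subgroup.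
[cite: Kida2019CountingCMTypes, Cor. 3.2] -/
theorem card_reflexTypesGE_eq_card_cmTypes (hρc : ∀ g : G, g * ρ = ρ * g) (hρ2 : ρ * ρ = 1) (K : Subgroup G) :
    (reflexTypesGE ρ K).card = (cmTypes ρ K).card := by
  refine Finset.card_bij' (fun S _ => S⁻¹) (fun S _ => S⁻¹) ?_ ?_ (fun S _ => inv_inv S) (fun S _ => inv_inv S)
  · intro S hS
    rw [mem_reflexTypesGE] at hS
    rw [mem_cmTypes]
    exact ⟨hS.1.inv hρc hρ2, by rw [rightStab_inv]; exact hS.2⟩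
  · intro S hS
    rw [mem_cmTypes] at hS
    rw [mem_reflexTypesGE]
    exact ⟨hS.1.inv hρc hρ2, by rw [leftStab_inv]; exact hS.2⟩

/-! ### Proposition 3.3 (CM types of `(G, H, ρ)` with a given reflex subgroup) and Corollary 3.4 -/

/-- `X̄(H, K) = ⨆_{K₁ ⊇ K} (𝒮̄(H) ∩ ℛ(K₁))`, a disjoint union. [cite: Kida2019CountingCMTypes, Prop. 3.3 (proof)] -/
theorem Xbar_eq_biUnion_reflex (H K : Subgroup G) :
    Xbar ρ H K = (Finset.Ici K).biUnion fun K₁ => (cmTypes ρ H).filter fun S => leftStab S = K₁ := by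
  ext S
  simp only [mem_Xbar, Finset.mem_biUnion, Finset.mem_Ici, Finset.mem_filter, mem_cmTypes]
  constructor
  · rintro ⟨hS, hH, hK⟩
    exact ⟨leftStab S, hK, ⟨hS, hH⟩, rfl⟩
  · rintro ⟨K₁, hK, ⟨hS, hH⟩, rfl⟩
    exact ⟨hS, hH, hK⟩

/-- `|X̄(H, K)| = Σ_{K₁ ⊇ K} |𝒮̄(H) ∩ ℛ(K₁)|`. [cite: Kida2019CountingCMTypes, Prop. 3.3 (proof)] -/
theorem card_Xbar_eq_sum_card_cmTypes_filter (H K : Subgroup G) :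
    (Xbar ρ H K).card = ∑ K₁ ∈ Finset.Ici K, ((cmTypes ρ H).filter fun S => leftStab S = K₁).card := by
  rw [Xbar_eq_biUnion_reflex, Finset.card_biUnion]
  intro p _ q _ hpq
  rw [Function.onFun, Finset.disjoint_left]
  intro S hp hq
  rw [Finset.mem_filter] at hp hq
  exact hpq (hp.2.symm.trans hq.2)

/-- **PROPOSITION 3.3**: the number of CM types of `(G, H, ρ)` whose reflex subgroup is exactly `K` is
`|𝒮̄(H) ∩ ℛ(K)| = Σ_{N ∈ 𝓗(K)} ε(H, N)·μ(K, N)·2^{½|N\G/H|}`. [cite: Kida2019CountingCMTypes, Prop. 3.3] -/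
theorem card_cmTypes_filter_leftStab_eq_sum (hρc : ∀ g : G, g * ρ = ρ * g) (hρ2 : ρ * ρ = 1)
    (H K : Subgroup G) :
    (((cmTypes ρ H).filter fun S => leftStab S = K).card : ℤ) = ∑ N ∈ Finset.Ici K,
      if Eps ρ H N then mu ℤ K N * 2 ^ (Nat.card (DoubleCoset.Quotient (N : Set G) H) / 2) else 0 := by
  have h := moebius_inversion_top (𝕜 := ℤ) (α := Subgroup G)
    (fun N => (((cmTypes ρ H).filter fun S => leftStab S = N).card : ℤ))
    (fun N => ((Xbar ρ H N).card : ℤ)) (fun N => by rw [card_Xbar_eq_sum_card_cmTypes_filter]; push_cast; rfl) K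
  rw [h]
  refine Finset.sum_congr rfl fun N _ => ?_
  rw [card_Xbar hρc hρ2]
  split_ifs <;> simp

/-- **COROLLARY 3.4 (corrected form)**: `|𝒮(H) ∩ ℛ̄(K)| = |𝒮̄(K) ∩ ℛ(H)|` — the simple CM types of `(G, H, ρ)` whose
reflex subgroup CONTAINS `K` are as many as the CM types of `(G, K, ρ)` whose reflex subgroup is EXACTLY `H`
(bijection `S ↦ S⁻¹`; equivalently `Σ_{K₁ ⊇ K} |X(H, K₁)| = Σ_{K₁ ⊇ K} |X(K₁, H)|` by Cor. 2.5, which is the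
computation printed under Cor. 3.4).  The printed statement «`|𝒮̄(H) ∩ ℛ(K)| = |𝒮̄(K) ∩ ℛ(H)|`» replaces
`𝒮(H) ∩ ℛ̄(K)` by `𝒮̄(H) ∩ ℛ(K)` and is false in general — see `card_cmTypes_filter_ne_of_isCompl` below.
[cite: Kida2019CountingCMTypes, Cor. 3.4] -/
theorem card_simpleTypes_filter_le_leftStab_eq (hρc : ∀ g : G, g * ρ = ρ * g) (hρ2 : ρ * ρ = 1)
    (H K : Subgroup G) :
    ((simpleTypes ρ H).filter fun S => K ≤ leftStab S).card =
      ((cmTypes ρ K).filter fun S => leftStab S = H).card := by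
  refine Finset.card_bij' (fun S _ => S⁻¹) (fun S _ => S⁻¹) ?_ ?_ (fun S _ => inv_inv S) (fun S _ => inv_inv S)
  · intro S hS
    rw [Finset.mem_filter, mem_simpleTypes] at hS
    rw [Finset.mem_filter, mem_cmTypes]
    exact ⟨⟨hS.1.1.inv hρc hρ2, by rw [rightStab_inv]; exact hS.2⟩, by rw [leftStab_inv, hS.1.2]⟩
  · intro S hS
    rw [Finset.mem_filter, mem_cmTypes] at hS
    rw [Finset.mem_filter, mem_simpleTypes]
    exact ⟨⟨hS.1.1.inv hρc hρ2, by rw [rightStab_inv, hS.2]⟩, by rw [leftStab_inv]; exact hS.1.2⟩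

/-- The computation printed under Cor. 3.4: `Σ_{K₁ ⊇ K} |X(H, K₁)| = Σ_{K₁ ⊇ K} |X(K₁, H)|` (termwise Cor. 2.5); the
left side is `|𝒮(H) ∩ ℛ̄(K)|`, the right side `|𝒮̄(K) ∩ ℛ(H)|`. [cite: Kida2019CountingCMTypes, Cor. 3.4 (proof)] -/
theorem sum_card_X_eq_sum_card_X_symm (hρc : ∀ g : G, g * ρ = ρ * g) (hρ2 : ρ * ρ = 1) (H K : Subgroup G) :
    ∑ K₁ ∈ Finset.Ici K, (X ρ H K₁).card = ∑ K₁ ∈ Finset.Ici K, (X ρ K₁ H).card :=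
  Finset.sum_congr rfl fun K₁ _ => card_X_symm hρc hρ2 H K₁

omit [Fintype G] in
/-- In a COMMUTATIVE group the two stabilisers coincide. [folklore] -/
private theorem leftStab_eq_rightStab_of_comm (hG : ∀ a b : G, a * b = b * a) (S : Finset G) :
    leftStab S = rightStab S := by
  ext g
  rw [mem_leftStab_iff, mem_rightStab_iff]
  exact forall_congr' fun x => by rw [hG g x]

/-- A subgroup `A` complementary to `{1, ρ}` (`ρ ∉ A`, `G = A ∪ ρA`) IS a half-system, with both stabilisers equal to
`A` when `G` is commutative. [folklore] -/
private theorem complement_mem_halfSystems {A : Subgroup G} (hρA : ρ ∉ A)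
    (hcov : ∀ x : G, x ∈ A ∨ ρ * x ∈ A) :
    IsHalfSystem ρ (Finset.univ.filter fun x => x ∈ A) ∧
      rightStab (Finset.univ.filter fun x => x ∈ A) = A := by
  have hS : IsHalfSystem ρ (Finset.univ.filter fun x => x ∈ A) := by
    intro x
    simp only [Finset.mem_filter, Finset.mem_univ, true_and]
    constructor
    · intro hx hρx
      exact hρA (by simpa using A.mul_mem hρx (A.inv_mem hx))
    · intro h
      exact (hcov x).resolve_right h
  refine ⟨hS, ?_⟩
  ext g
  simp only [mem_rightStab_iff, Finset.mem_filter, Finset.mem_univ, true_and]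
  constructor
  · intro h
    simpa using (h 1).2 A.one_mem
  · intro hg x
    constructor
    · intro h
      simpa using A.mul_mem h (A.inv_mem hg)
    · intro h
      exact A.mul_mem h hg

/-- **The printed form of Cor. 3.4 fails**: in a commutative `G` with a subgroup `A ≠ 1` complementary to `{1, ρ}`
(e.g. `G = V₄ = {1, ρ} × {1, a}`, `A = {1, a}`), for `H = 1`, `K = A` one has `|𝒮̄(1) ∩ ℛ(A)| ≥ 1` (the half-system
`A` itself has reflex subgroup `A`) but `|𝒮̄(A) ∩ ℛ(1)| = 0` (a CM type of `(G, A, ρ)` has reflex subgroup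
`⊇ A ≠ 1`, the stabilisers of a commutative group being two-sided). [cite: Kida2019CountingCMTypes, Cor. 3.4] -/
theorem card_cmTypes_filter_ne_of_isCompl (hG : ∀ a b : G, a * b = b * a) {A : Subgroup G}
    (hA : A ≠ ⊥) (hρA : ρ ∉ A) (hcov : ∀ x : G, x ∈ A ∨ ρ * x ∈ A) :
    ((cmTypes ρ ⊥).filter fun S => leftStab S = A).card ≠ ((cmTypes ρ A).filter fun S => leftStab S = ⊥).card := by
  have h0 : ((cmTypes ρ A).filter fun S => leftStab S = ⊥) = ∅ := by
    rw [Finset.eq_empty_iff_forall_notMem]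
    intro S hS
    rw [Finset.mem_filter, mem_cmTypes] at hS
    apply hA
    rw [eq_bot_iff, ← hS.2, leftStab_eq_rightStab_of_comm hG]
    exact hS.1.2
  have h1 : (Finset.univ.filter fun x => x ∈ A) ∈ (cmTypes ρ ⊥).filter fun S => leftStab S = A := by
    obtain ⟨hS, hstab⟩ := complement_mem_halfSystems hρA hcov
    rw [Finset.mem_filter, mem_cmTypes]
    exact ⟨⟨hS, bot_le⟩, by rw [leftStab_eq_rightStab_of_comm hG, hstab]⟩
  rw [h0, Finset.card_empty]
  exact Finset.card_ne_zero_of_mem h1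

end Moebius


/-! ## §5 Theorem 4.1 (the number of conjugacy classes) and Remark 4.3 -/

section ConjugacyClasses

variable [Fintype G]

/-- `CM(G, H, ρ)` is stable under LEFT translation `S ↦ gS` (Kida's conjugation `S ↦ Sg` read through `S ↦ S⁻¹`):
the conjugation action as a sub-action of the pointwise action of `G` on `Finset G`; its orbits are the
CONJUGACY CLASSES of CM types of `(G, H, ρ)` («Two CM-types `S₁` and `S₂` in `CM(G, H, ρ)` are conjugate if there
exists `g ∈ G` such that `S₁ = S₂g` … A conjugacy class of simple CM-types determines an isogeny class of complex
abelian varieties with complex multiplication by an order of `M`»). [cite: Kida2019CountingCMTypes, §1, §4] -/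
def cmTypesSubMulAction (ρ : G) (hρc : ∀ g : G, g * ρ = ρ * g) (H : Subgroup G) : SubMulAction G (Finset G) where
  carrier := ↑(cmTypes ρ H)
  smul_mem' g S hS := by
    simp only [Finset.mem_coe, mem_cmTypes] at hS ⊢
    exact ⟨hS.1.smul hρc g, by rw [rightStab_smul]; exact hS.2⟩

variable {hρc : ∀ g : G, g * ρ = ρ * g} {H : Subgroup G}

/-- Membership in the conjugation action (unfolding). [cite: Kida2019CountingCMTypes, §4] -/
theorem mem_cmTypesSubMulAction {S : Finset G} : S ∈ cmTypesSubMulAction ρ hρc H ↔ S ∈ cmTypes ρ H :=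
  Finset.mem_coe

/-- The type of CM types of `(G, H, ρ)` with its conjugation action is finite. [cite: Kida2019CountingCMTypes, §4] -/
instance fintypeCMTypesSubMulAction : Fintype (cmTypesSubMulAction ρ hρc H) := Fintype.ofFinite _

/-- The set of conjugacy classes `CM(G, H, ρ)/G` is finite. [cite: Kida2019CountingCMTypes, §4] -/
instance fintypeOrbitQuotient : Fintype (MulAction.orbitRel.Quotient G (cmTypesSubMulAction ρ hρc H)) :=
  Fintype.ofFinite _

/-- «`Sg = S` holds if and only if `g ∈ r(S)`»: the stabiliser of a CM type under conjugation is its REFLEX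
subgroup (left stabiliser). [cite: Kida2019CountingCMTypes, Prop. 4.2 (proof)] -/
theorem stabilizer_eq_leftStab (S : cmTypesSubMulAction ρ hρc H) :
    MulAction.stabilizer G S = leftStab (S : Finset G) := by
  ext g
  rw [MulAction.mem_stabilizer_iff, ← Subtype.coe_inj, SubMulAction.val_smul, mem_leftStab_iff]
  constructor
  · intro h x
    conv_rhs => rw [← Finset.smul_mem_smul_finset_iff (a := g), h]
    rfl
  · intro h
    ext z
    rw [← Finset.inv_smul_mem_iff, smul_eq_mul]
    simpa using (h (g⁻¹ * z)).symm

/-- Double counting `{(g, S) | gS = S}`: `Σ_g |Fix g| = Σ_S |Stab S|`. [folklore] -/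
private theorem sum_card_fixedBy_eq_sum_card_stabilizer {X : Type*} [Fintype X] [MulAction G X]
    [∀ g : G, Fintype (MulAction.fixedBy X g)] [∀ x : X, Fintype (MulAction.stabilizer G x)] :
    ∑ g : G, Fintype.card (MulAction.fixedBy X g) = ∑ x : X, Fintype.card (MulAction.stabilizer G x) := by
  have h1 : ∀ g : G, Fintype.card (MulAction.fixedBy X g) = (Finset.univ.filter fun x : X => g • x = x).card :=
    fun g => Fintype.card_of_subtype _ fun x => by simp
  have h2 : ∀ x : X, Fintype.card (MulAction.stabilizer G x) = (Finset.univ.filter fun g : G => g • x = x).card :=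
    fun x => Fintype.card_of_subtype _ fun g => by simp
  simp_rw [h1, h2, Finset.card_filter]
  exact Finset.sum_comm

/-- **THEOREM 4.1 (first equality, Burnside): `|G|·c(G, H, ρ) = Σ_{S ∈ CM(G,H,ρ)} |r(S)|`** — the number
`c(G, H, ρ)` of conjugacy classes of CM types of `(G, H, ρ)` times `|G|` is the sum of the orders of the reflex
subgroups («from the lemma of Burnside and Frobenius …»). [cite: Kida2019CountingCMTypes, Thm. 4.1] -/
theorem card_orbits_mul_card_group (hρc : ∀ g : G, g * ρ = ρ * g) (H : Subgroup G) :
    Nat.card (MulAction.orbitRel.Quotient G (cmTypesSubMulAction ρ hρc H)) * Nat.card G =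
      ∑ S ∈ cmTypes ρ H, Nat.card (leftStab S) := by
  have hB := MulAction.sum_card_fixedBy_eq_card_orbits_mul_card_group G (cmTypesSubMulAction ρ hρc H)
  rw [Nat.card_eq_fintype_card, Nat.card_eq_fintype_card, ← hB, sum_card_fixedBy_eq_sum_card_stabilizer]
  have h2 : ∀ x : cmTypesSubMulAction ρ hρc H,
      Fintype.card (MulAction.stabilizer G x) = Nat.card (leftStab (x : Finset G)) := fun x => by
    rw [← Nat.card_eq_fintype_card, stabilizer_eq_leftStab]
  simp_rw [h2]
  exact (Finset.sum_subtype (cmTypes ρ H) (fun S => (mem_cmTypesSubMulAction (ρ := ρ) (hρc := hρc) (H := H)).symm)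
    (fun S => Nat.card (leftStab S))).symm

/-- **THEOREM 4.1 (second form): `|G|·c(G, H, ρ) = Σ_K |K|·|𝒮̄(H) ∩ ℛ(K)|`**, grouping the CM types by their reflex
subgroup; with Prop. 3.3 this is Kida's closed formula
`c(G,H,ρ) = |G|⁻¹ Σ_K |K| Σ_{N ∈ 𝓗(K)} ε(H,N) μ(K,N) 2^{½|N\G/H|}` (`card_cmTypes_filter_leftStab_eq_sum`).
[cite: Kida2019CountingCMTypes, Thm. 4.1] -/
theorem card_orbits_mul_card_group_eq_sum_reflex (hρc : ∀ g : G, g * ρ = ρ * g) (H : Subgroup G) :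
    Nat.card (MulAction.orbitRel.Quotient G (cmTypesSubMulAction ρ hρc H)) * Nat.card G =
      ∑ K : Subgroup G, Nat.card K * ((cmTypes ρ H).filter fun S => leftStab S = K).card := by
  rw [card_orbits_mul_card_group hρc H, ← Finset.sum_fiberwise_of_maps_to (g := leftStab) (t := Finset.univ)
    (fun S _ => Finset.mem_univ _)]
  refine Finset.sum_congr rfl fun K _ => ?_
  rw [mul_comm, Finset.sum_const_nat fun S hS => ?_]
  rw [(Finset.mem_filter.1 hS).2]

/-- PROPOSITION 4.2 in its exact content: the orbit (conjugacy class) of `S ∈ CM(G, H, ρ)` has `(G : r(S))`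
elements (orbit–stabiliser). [cite: Kida2019CountingCMTypes, Prop. 4.2] -/
theorem ncard_orbit_eq_index_leftStab (S : cmTypesSubMulAction ρ hρc H) :
    (MulAction.orbit G S).ncard = (leftStab (S : Finset G)).index := by
  rw [← stabilizer_eq_leftStab, MulAction.index_stabilizer]

/-- **REMARK 4.3: `Σ_{classes} (G : r(S)) = |CM(G, H, ρ)|`** — summing the index of the reflex subgroup (= the degree
`[L_K : ℚ]` of the reflex field, `|G|/|K|`) over a system of representatives of the conjugacy classes gives the
number of CM types («Hence the sum of `[L_K : ℚ]` over a representative of the conjugacy classes of `CM(G, H, ρ)` is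
`2^{½|H\G|}`.  This fact was previously noticed by Dodson [1984, p. 5] and Oishi-Tomiyasu [2010, Lemma 1.4]»).
[cite: Kida2019CountingCMTypes, Rem. 4.3] -/
theorem sum_index_leftStab_out_eq_card (hρc : ∀ g : G, g * ρ = ρ * g) (H : Subgroup G) :
    ∑ ω : MulAction.orbitRel.Quotient G (cmTypesSubMulAction ρ hρc H),
      (leftStab ((ω.out : cmTypesSubMulAction ρ hρc H) : Finset G)).index = (cmTypes ρ H).card := by
  have h1 : ∀ ω : MulAction.orbitRel.Quotient G (cmTypesSubMulAction ρ hρc H),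
      (leftStab ((ω.out : cmTypesSubMulAction ρ hρc H) : Finset G)).index =
        Nat.card (MulAction.orbit G (ω.out : cmTypesSubMulAction ρ hρc H)) := fun ω => by
    rw [← ncard_orbit_eq_index_leftStab, Nat.card_coe_set_eq]
  simp_rw [h1]
  rw [← Nat.card_sigma, ← Nat.card_congr (MulAction.selfEquivSigmaOrbits G (cmTypesSubMulAction ρ hρc H)),
    Nat.card_eq_fintype_card]
  exact Fintype.card_of_subtype (cmTypes ρ H)
    (fun S => (mem_cmTypesSubMulAction (ρ := ρ) (hρc := hρc) (H := H)).symm)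

/-- REMARK 4.3, numerically: `Σ_{classes} (G : r(S)) = 2^{½(G:H)}` for a CM subgroup `H` («previously noticed by
Dodson [1984, p. 5]»: `2ⁿ = Σ_Φ [K'_Φ : ℚ]`). [cite: Kida2019CountingCMTypes, Rem. 4.3] -/
theorem sum_index_leftStab_out_eq_two_pow (hρc : ∀ g : G, g * ρ = ρ * g) (hρ2 : ρ * ρ = 1) {H : Subgroup G}
    (hH : ρ ∉ H) :
    ∑ ω : MulAction.orbitRel.Quotient G (cmTypesSubMulAction ρ hρc H),
      (leftStab ((ω.out : cmTypesSubMulAction ρ hρc H) : Finset G)).index = 2 ^ (H.index / 2) := by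
  rw [sum_index_leftStab_out_eq_card, card_cmTypes hρc hρ2, if_neg hH]

end ConjugacyClasses

end CMTypeCounting

end Literature.NumberTheory.ComplexMultiplication
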